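import Literature.NumberTheory.Sieve.PrimesInAPGallagherRange
import Literature.NumberTheory.Sieve.MontgomeryVaughan1975Lemma43NonExceptional
import Literature.NumberTheory.Sieve.ShiftedPrimeDivisors
import HarnessLib

/-!
# Primes `p ≡ 1 (mod d)` for all moduli `d ≤ N^δ` off one exceptional modulus — UNCONDITIONAL

Topic `Literature/NumberTheory/Sieve`. THEOREMS only. Companion of
`PrimesInAPGallagherRange.lean`, which derived the lower bound
`#{p ≤ N : p ≡ 1 (mod d)} ≥ N/(2φ(d) log N)` (`1 ≤ d ≤ N^δ`, `b ∤ d`, hypothesis (H) of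
`ShiftedPrimeDivisors.lean`) from the tree's named fact
`Literature.NumberTheory.Sieve.MontgomeryVaughan1975.lemma43_gallagher` (Gallagher's Theorem 7 with
the exceptional term corrected — behind it the Deuring–Heilbronn phenomenon, not yet in the tree).
The derivation only ever used the terms of the characters mod `d` with `r̃ ∤ d`, none of which is
the exceptional character; so the DH-free form of Gallagher's theorem PROVED in
`MontgomeryVaughan1975Lemma43NonExceptional.lean`
(`Literature.NumberTheory.Sieve.MontgomeryVaughan1975.gallagher_nonexceptional`, from the
explicit formulae and the first part of Bombieri's Théorème 14, all theorems of the tree) suffices,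
and (H) becomes a THEOREM: `primesInAP_lowerBound`.

* `sum_conductor_primitiveCharacter_le_filter` — the embedding `χ ↦ (f, χ⋆)` of the characters
  mod `d` into the primitive characters of conductor `≤ P`, restricted to any sub-family
  containing all the `χ⋆`;
* `sum_norm_gallagherTerm_le_nonexceptional` — `∑_{χ mod d} ‖∑# χ⋆‖ ≤ (N + N/P) K e^{−c log N/log P}`
  for `d ≤ P` not divisible by `b` (`b = r̃` or `⌊P⌋ + 1`), from `gallagher_nonexceptional`;
* `primesInAP_lowerBound_of_sumBound` — the deduction of (H) from such a bound (the argument of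
  `primesInAP_lowerBound_of_lemma43_gallagher`, verbatim);
* `primesInAP_lowerBound` — (H), unconditionally;
* `Literature.NumberTheory.Sieve.AdlemanPomeranceRumely1983_prop10` — hence Adleman–Pomerance–Rumely's
  Proposition 10 (integers with `exp(C log n/log log n)` shifted-prime divisors, infinitely often),
  unconditionally (`ShiftedPrimeDivisors.infinite_setOf_exp_le_card_shiftedPrimeDivisors`).

## References

* P. X. Gallagher, Invent. Math. 11 (1970) 329–339, Theorem 7 [Gallagher1970].
* H. L. Montgomery, R. C. Vaughan, Acta Arith. 27 (1975) 353–370, §4 Lemma 4.3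
  [MontgomeryVaughanActa1975].
* L. M. Adleman, C. Pomerance, R. S. Rumely, Ann. of Math. 117 (1983) 173–206, Proposition 10
  [AdlemanPomeranceRumely1983].
-/

noncomputable section

open Finset Real Filter

namespace Literature.NumberTheory.Sieve

namespace PrimesInAPGallagher

open MontgomeryVaughan1975

/-! ### The embedding into a sub-family of the primitive characters -/

/-- **The characters mod `d` embed into any family of primitive characters containing their
inducers** (`d ≤ P`): for non-negative `G`, a predicate `p` (with any decidability instances) such
that `p(f, χ⋆)` holds for the conductor `f` and the primitive character `χ⋆` of every `χ` mod `d`,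
`∑_{χ mod d} G(f, χ⋆) ≤ ∑_{q ≤ P} ∑_{ψ mod q, p(q, ψ)} G(q, ψ)`. [folklore] -/
theorem sum_conductor_primitiveCharacter_le_filter {d : ℕ} [NeZero d] {P : ℝ} (hdP : (d : ℝ) ≤ P)
    (G : (q : ℕ) → DirichletCharacter ℂ q → ℝ) (hG : ∀ q ψ, 0 ≤ G q ψ)
    (p : (q : ℕ) → DirichletCharacter ℂ q → Prop) (D : (q : ℕ) → DecidablePred (p q))
    (hp : ∀ χ : DirichletCharacter ℂ d, p χ.conductor χ.primitiveCharacter) :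
    ∑ χ : DirichletCharacter ℂ d, G χ.conductor χ.primitiveCharacter ≤
      ∑ q ∈ Icc 1 ⌊P⌋₊, ∑ ψ ∈ @Finset.filter _ (p q) (D q) univ, G q ψ := by
  classical
  set Φ : DirichletCharacter ℂ d → (Σ q : ℕ, DirichletCharacter ℂ q) :=
    fun χ => ⟨χ.conductor, χ.primitiveCharacter⟩ with hΦ
  have key : ∀ {n₁ n₂ : ℕ} (ψ₁ : DirichletCharacter ℂ n₁) (ψ₂ : DirichletCharacter ℂ n₂)
      (h₁ : n₁ ∣ d) (h₂ : n₂ ∣ d),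
      (⟨n₁, ψ₁⟩ : Σ q : ℕ, DirichletCharacter ℂ q) = ⟨n₂, ψ₂⟩ →
        DirichletCharacter.changeLevel h₁ ψ₁ = DirichletCharacter.changeLevel h₂ ψ₂ := by
    intro n₁ n₂ ψ₁ ψ₂ h₁ h₂ h
    cases h
    rfl
  have hinj : ∀ χ₁ ∈ (univ : Finset (DirichletCharacter ℂ d)), ∀ χ₂ ∈ (univ : Finset _),
      Φ χ₁ = Φ χ₂ → χ₁ = χ₂ := by
    intro χ₁ _ χ₂ _ h
    have := key χ₁.primitiveCharacter χ₂.primitiveCharacter χ₁.conductor_dvd_level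
      χ₂.conductor_dvd_level h
    rwa [DirichletCharacter.changeLevel_primitiveCharacter,
      DirichletCharacter.changeLevel_primitiveCharacter] at this
  have hsub : (univ : Finset (DirichletCharacter ℂ d)).image Φ ⊆
      (Icc 1 ⌊P⌋₊).sigma (fun q => @Finset.filter _ (p q) (D q) univ) := by
    intro x hx
    obtain ⟨χ, -, rfl⟩ := Finset.mem_image.mp hx
    refine Finset.mem_sigma.mpr ⟨Finset.mem_Icc.mpr ⟨?_, ?_⟩, ?_⟩
    · exact Nat.one_le_iff_ne_zero.mpr χ.conductor_ne_zero
    · refine Nat.le_floor ?_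
      have : χ.conductor ≤ d := Nat.le_of_dvd (NeZero.pos d) χ.conductor_dvd_level
      exact le_trans (by exact_mod_cast this) hdP
    · exact Finset.mem_filter.mpr ⟨Finset.mem_univ _, hp χ⟩
  calc ∑ χ : DirichletCharacter ℂ d, G χ.conductor χ.primitiveCharacter
      = ∑ x ∈ (univ : Finset (DirichletCharacter ℂ d)).image Φ, G x.1 x.2 := by
        rw [Finset.sum_image hinj]
    _ ≤ ∑ x ∈ (Icc 1 ⌊P⌋₊).sigma (fun q => @Finset.filter _ (p q) (D q) univ), G x.1 x.2 :=
        Finset.sum_le_sum_of_subset_of_nonneg hsub fun x _ _ => hG _ _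
    _ = _ := by rw [Finset.sum_sigma']

/-! ### The input from the DH-free Gallagher theorem -/

/-- **Per-modulus bound from the DH-free Gallagher theorem** (`gallagher_nonexceptional` at
`x = h = N`): there are `c₃, c₄, K > 0` such that for `N ≥ 2`, `exp(log^{1/2} N) ≤ P ≤ N^{c₄}`,
`P ≥ 1`, there is `b ≥ 2` (the exceptional conductor `r̃` if the exceptional character occurs at
level `P`, else `⌊P⌋ + 1`) with `∑_{χ mod d} ‖∑#_{p ≤ N} χ⋆(p) log p‖ ≤ (N + N/P) K exp(−c₃ log N/log P)`
for every `d ≤ P` with `b ∤ d` (when `r̃ ∤ d` no character mod `d` is induced by `χ̃`, so the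
characters mod `d` embed into the non-exceptional family). Unconditional.
[cite: Gallagher1970, Theorem 7] [cite: MontgomeryVaughanActa1975, §4 Lemma 4.3 (4.2)] -/
theorem sum_norm_gallagherTerm_le_nonexceptional :
    ∃ c₃ : ℝ, 0 < c₃ ∧ ∃ c₄ : ℝ, 0 < c₄ ∧ ∃ K : ℝ, 0 < K ∧
      ∀ (N : ℕ) (P : ℝ), 2 ≤ N → Real.exp (Real.sqrt (Real.log N)) ≤ P → P ≤ (N : ℝ) ^ c₄ →
        1 ≤ P → ∃ b : ℕ, 2 ≤ b ∧ ∀ (d : ℕ) [NeZero d], (d : ℝ) ≤ P → ¬ b ∣ d →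
          ∑ χ : DirichletCharacter ℂ d, ‖gallagherTerm χ.primitiveCharacter N N‖ ≤
            ((N : ℝ) + N / P) * K * Real.exp (-c₃ * Real.log N / Real.log P) := by
  classical
  obtain ⟨c₁, hc₁, c₄, hc₄, C, h⟩ := gallagher_nonexceptional
  refine ⟨c₁, hc₁, c₄, hc₄, max C 0 + 1, by positivity, ?_⟩
  intro N P hN hP1 hP2 hP3
  obtain ⟨hA, hB⟩ := h N P hN hP1 hP2 (fun _ _ => N) (fun _ _ => N) (fun _ _ => le_rfl)
    (fun _ _ => le_rfl)
  set E : ℝ := Real.exp (-c₁ * Real.log N / Real.log P) with hE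
  have hE0 : 0 < E := Real.exp_pos _
  have hN0 : (0 : ℝ) < N := by exact_mod_cast (show 0 < N by omega)
  have hNP : 0 < (N : ℝ) + N / P := by positivity
  have hC : C ≤ max C 0 + 1 := by have := le_max_left C 0; linarith
  by_cases hex : ∃ (r : ℕ) (_ : NeZero r) (χe : DirichletCharacter ℂ r) (β : ℝ),
      IsExceptionalZero c₁ P r χe β
  · -- the exceptional character occurs: `b = r̃`, and the family without `χ̃`
    obtain ⟨r, hr, χe, β, hexc⟩ := hex
    have hB' := hB r χe β hexc
    have hr2 : 2 ≤ r := by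
      obtain ⟨_, hne, -⟩ := hexc
      have hr0 : r ≠ 0 := NeZero.ne r
      have hr1 : r ≠ 1 := by
        rintro rfl; exact hne (DirichletCharacter.level_one χe)
      omega
    refine ⟨r, hr2, fun d _ hdP hrd => ?_⟩
    have hemb := sum_conductor_primitiveCharacter_le_filter hdP
      (fun q ψ => ((N : ℝ) + N / P)⁻¹ * ‖gallagherTerm ψ N N‖) (fun q ψ => by positivity)
      (fun q ψ => ψ.IsPrimitive ∧ ¬ (q = r ∧ ∀ n : ℕ, ψ (n : ZMod q) = χe (n : ZMod r)))
      (fun q => inferInstance) (fun χ => ⟨χ.primitiveCharacter_isPrimitive, fun hh =>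
        hrd (hh.1 ▸ χ.conductor_dvd_level)⟩)
    have hbound : ∑ χ : DirichletCharacter ℂ d,
        ((N : ℝ) + N / P)⁻¹ * ‖gallagherTerm χ.primitiveCharacter N N‖ ≤ C * E := by
      refine hemb.trans ?_
      convert hB' using 2
    have hsum : ∑ χ : DirichletCharacter ℂ d, ‖gallagherTerm χ.primitiveCharacter N N‖ =
        ((N : ℝ) + N / P) * ∑ χ : DirichletCharacter ℂ d,
          ((N : ℝ) + N / P)⁻¹ * ‖gallagherTerm χ.primitiveCharacter N N‖ := by
      rw [Finset.mul_sum]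
      refine Finset.sum_congr rfl fun χ _ => ?_
      rw [← mul_assoc, mul_inv_cancel₀ hNP.ne', one_mul]
    rw [hsum, mul_assoc]
    refine mul_le_mul_of_nonneg_left ?_ hNP.le
    calc _ ≤ C * E := hbound
      _ ≤ (max C 0 + 1) * E := mul_le_mul_of_nonneg_right hC hE0.le
  · -- no exceptional character: `b = ⌊P⌋ + 1` divides no `d ≤ P`
    push Not at hex
    have hA' := hA (fun r _ χ β hx => hex r inferInstance χ β hx)
    refine ⟨⌊P⌋₊ + 1, by have := Nat.le_floor (by exact_mod_cast hP3 : ((1 : ℕ) : ℝ) ≤ P); omega,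
      fun d _ hdP _ => ?_⟩
    have hemb := sum_conductor_primitiveCharacter_le_filter hdP
      (fun q ψ => ((N : ℝ) + N / P)⁻¹ * ‖gallagherTerm ψ N N‖) (fun q ψ => by positivity)
      (fun q ψ => ψ.IsPrimitive) (fun q => inferInstance) (fun χ => χ.primitiveCharacter_isPrimitive)
    have hbound : ∑ χ : DirichletCharacter ℂ d,
        ((N : ℝ) + N / P)⁻¹ * ‖gallagherTerm χ.primitiveCharacter N N‖ ≤ C * E := by
      refine hemb.trans ?_
      convert hA' using 2
    have hsum : ∑ χ : DirichletCharacter ℂ d, ‖gallagherTerm χ.primitiveCharacter N N‖ =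
        ((N : ℝ) + N / P) * ∑ χ : DirichletCharacter ℂ d,
          ((N : ℝ) + N / P)⁻¹ * ‖gallagherTerm χ.primitiveCharacter N N‖ := by
      rw [Finset.mul_sum]
      refine Finset.sum_congr rfl fun χ _ => ?_
      rw [← mul_assoc, mul_inv_cancel₀ hNP.ne', one_mul]
    rw [hsum, mul_assoc]
    refine mul_le_mul_of_nonneg_left ?_ hNP.le
    calc _ ≤ C * E := hbound
      _ ≤ (max C 0 + 1) * E := mul_le_mul_of_nonneg_right hC hE0.le

/-! ### The lower bound for primes `p ≡ 1 (mod d)` -/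

/-- **Primes `p ≡ 1 (mod d)` in the Linnik–Gallagher range from a per-modulus bound for the
sums `∑# χ⋆`** (the deduction of `primesInAP_lowerBound_of_lemma43_gallagher`, with its input
abstracted): if `∑_{χ mod d} ‖∑#_{p ≤ N} χ⋆(p) log p‖ ≤ (N + N/P) K e^{−c₃ log N/log P}` for
`N ≥ 2`, `exp(log^{1/2} N) ≤ P ≤ N^{c₄}`, `d ≤ P`, `b ∤ d`, then (H): for `N ≥ N₀` there is `b ≥ 2`
with `#{p ≤ N : p ≡ 1 (mod d)} ≥ (1/2) N/(φ(d) log N)` for all `1 ≤ d ≤ N^δ`, `b ∤ d`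
(`δ = min(c₄, 1/2, c₃/(16K))`; orthogonality, `totient_mul_theta_ge`).
[cite: Gallagher1970, Theorem 7 (the deduction of primes in progressions)] -/
theorem primesInAP_lowerBound_of_sumBound
    (hsum : ∃ c₃ : ℝ, 0 < c₃ ∧ ∃ c₄ : ℝ, 0 < c₄ ∧ ∃ K : ℝ, 0 < K ∧
      ∀ (N : ℕ) (P : ℝ), 2 ≤ N → Real.exp (Real.sqrt (Real.log N)) ≤ P → P ≤ (N : ℝ) ^ c₄ →
        1 ≤ P → ∃ b : ℕ, 2 ≤ b ∧ ∀ (d : ℕ) [NeZero d], (d : ℝ) ≤ P → ¬ b ∣ d →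
          ∑ χ : DirichletCharacter ℂ d, ‖gallagherTerm χ.primitiveCharacter N N‖ ≤
            ((N : ℝ) + N / P) * K * Real.exp (-c₃ * Real.log N / Real.log P)) :
    ∃ c : ℝ, 0 < c ∧ ∃ δ : ℝ, 0 < δ ∧ ∃ N₀ : ℕ, ∀ N : ℕ, N₀ ≤ N → ∃ b : ℕ, 2 ≤ b ∧
      ∀ d : ℕ, 1 ≤ d → (d : ℝ) ≤ (N : ℝ) ^ δ → ¬ b ∣ d →
        c * N / (Nat.totient d * Real.log N) ≤
          (((Finset.Iic N).filter (fun p => p.Prime ∧ p ≡ 1 [MOD d])).card : ℝ) := by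
  classical
  obtain ⟨c₃, hc₃, c₄, hc₄, K, hK, hE⟩ := hsum
  set δ : ℝ := min (min c₄ (1 / 2)) (c₃ / (16 * K)) with hδ
  have hδ0 : 0 < δ := lt_min (lt_min hc₄ (by norm_num)) (by positivity)
  have hδc₄ : δ ≤ c₄ := (min_le_left _ _).trans (min_le_left _ _)
  have hδh : δ ≤ 1 / 2 := (min_le_left _ _).trans (min_le_right _ _)
  have hδK : δ ≤ c₃ / (16 * K) := min_le_right _ _
  refine ⟨1 / 2, by norm_num, δ, hδ0, ?_⟩
  -- eventual conditions on `N`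
  have hlogN : Tendsto (fun N : ℕ => Real.log N) atTop atTop :=
    Real.tendsto_log_atTop.comp tendsto_natCast_atTop_atTop
  have hev : ∀ᶠ N : ℕ in atTop, 2 ≤ N ∧ 1 / δ ^ 2 ≤ Real.log N ∧
      Real.log N ≤ 1 / (4 * δ) * (N : ℝ) ^ (1 - δ) := by
    refine (eventually_ge_atTop 2).and ((hlogN.eventually (eventually_ge_atTop _)).and ?_)
    have h1 : ∀ᶠ x : ℝ in atTop, ‖Real.log x‖ ≤ 1 / (4 * δ) * ‖x ^ (1 - δ)‖ :=
      (isLittleO_log_rpow_atTop (by linarith : 0 < 1 - δ)).def (by positivity)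
    have h2 := tendsto_natCast_atTop_atTop.eventually (h1.and (eventually_ge_atTop (1 : ℝ)))
    filter_upwards [h2] with N hN
    obtain ⟨hN, hN1⟩ := hN
    rwa [Real.norm_of_nonneg (Real.log_nonneg hN1),
      Real.norm_of_nonneg (Real.rpow_nonneg (by linarith) _)] at hN
  obtain ⟨N₀, hN₀⟩ := eventually_atTop.mp hev
  refine ⟨N₀, fun N hN => ?_⟩
  obtain ⟨hN2, hlog1, hlog2⟩ := hN₀ N hN
  have hN0 : (0 : ℝ) < N := by exact_mod_cast (show 0 < N by omega)
  have hN1 : (1 : ℝ) < N := by exact_mod_cast (show 1 < N by omega)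
  have hL0 : 0 < Real.log N := Real.log_pos hN1
  set P : ℝ := (N : ℝ) ^ δ with hP
  have hP1 : 1 ≤ P := Real.one_le_rpow hN1.le hδ0.le
  have hPc₄ : P ≤ (N : ℝ) ^ c₄ := Real.rpow_le_rpow_of_exponent_le hN1.le hδc₄
  have hlogP : Real.log P = δ * Real.log N := Real.log_rpow hN0 δ
  have hPexp : Real.exp (Real.sqrt (Real.log N)) ≤ P := by
    rw [hP, Real.rpow_def_of_pos hN0]
    refine Real.exp_le_exp.mpr ?_
    have hsq : Real.sqrt (Real.log N) * Real.sqrt (Real.log N) = Real.log N :=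
      Real.mul_self_sqrt hL0.le
    have h1 : 1 ≤ δ * Real.sqrt (Real.log N) := by
      have h0 : 0 ≤ δ * Real.sqrt (Real.log N) := by positivity
      have h2 : 1 ≤ (δ * Real.sqrt (Real.log N)) ^ 2 := by
        rw [mul_pow, Real.sq_sqrt hL0.le]
        have := hlog1
        rw [div_le_iff₀ (by positivity)] at this
        linarith
      nlinarith
    calc Real.sqrt (Real.log N) = Real.sqrt (Real.log N) * 1 := (mul_one _).symm
      _ ≤ Real.sqrt (Real.log N) * (δ * Real.sqrt (Real.log N)) :=
          mul_le_mul_of_nonneg_left h1 (Real.sqrt_nonneg _)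
      _ = Real.log N * δ := by
          rw [show Real.sqrt (Real.log N) * (δ * Real.sqrt (Real.log N)) =
            δ * (Real.sqrt (Real.log N) * Real.sqrt (Real.log N)) by ring, hsq, mul_comm]
  obtain ⟨b, hb2, hbd⟩ := hE N P hN2 hPexp hPc₄ hP1
  refine ⟨b, hb2, fun d hd1 hdP hbd' => ?_⟩
  haveI : NeZero d := ⟨by omega⟩
  -- the error term: `≤ (N + N/P) K e^{−c₃/δ} ≤ 2N K δ/c₃ ≤ N/8`
  have hexp : Real.exp (-c₃ * Real.log N / Real.log P) ≤ δ / c₃ := by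
    rw [hlogP]
    have : -c₃ * Real.log N / (δ * Real.log N) = -(c₃ / δ) := by field_simp
    rw [this, Real.exp_neg]
    have ht : 0 < c₃ / δ := by positivity
    have h1 := Real.add_one_le_exp (c₃ / δ)
    rw [inv_le_comm₀ (Real.exp_pos _) (by positivity), inv_div]
    linarith
  have hEd : ∑ χ : DirichletCharacter ℂ d, ‖gallagherTerm χ.primitiveCharacter N N‖ ≤
      (N : ℝ) / 8 := by
    refine (hbd d hdP hbd').trans ?_
    have h1 : (N : ℝ) + N / P ≤ 2 * N := by
      have : (N : ℝ) / P ≤ N := div_le_self hN0.le hP1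
      linarith
    calc ((N : ℝ) + N / P) * K * Real.exp (-c₃ * Real.log N / Real.log P)
        ≤ (2 * N) * K * (δ / c₃) := by gcongr
      _ ≤ (2 * N) * K * (c₃ / (16 * K) / c₃) := by gcongr
      _ = N / 8 := by field_simp; ring
  -- `φ(d) log d ≤ d log d ≤ N^δ · δ log N ≤ N/4`
  have hdlog : (d.totient : ℝ) * Real.log d ≤ (N : ℝ) / 4 := by
    have hφ : (d.totient : ℝ) ≤ d := by exact_mod_cast Nat.totient_le d
    have hd0 : (0 : ℝ) < d := by exact_mod_cast hd1
    have hlogd : Real.log d ≤ δ * Real.log N := by rw [← hlogP]; exact Real.log_le_log hd0 hdP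
    have hlogd0 : 0 ≤ Real.log d := Real.log_nonneg (by exact_mod_cast hd1)
    calc (d.totient : ℝ) * Real.log d ≤ d * Real.log d := mul_le_mul_of_nonneg_right hφ hlogd0
      _ ≤ P * (δ * Real.log N) := mul_le_mul hdP hlogd hlogd0 (by positivity)
      _ ≤ P * (δ * (1 / (4 * δ) * (N : ℝ) ^ (1 - δ))) := by gcongr
      _ = (N : ℝ) ^ δ * (N : ℝ) ^ (1 - δ) / 4 := by rw [hP]; field_simp
      _ = N / 4 := by rw [← Real.rpow_add hN0]; norm_num
  -- `θ(N; d, 1) ≥ N/(2 φ(d))`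
  have hθ := totient_mul_theta_ge (d := d) N
  set θ₁ : ℝ := ∑ p ∈ ((Ioc 0 N).filter Nat.Prime).filter (fun p : ℕ => (p : ZMod d) = 1),
    Real.log p with hθ₁
  have hφ0 : (0 : ℝ) < d.totient := by exact_mod_cast Nat.totient_pos.mpr (by omega)
  have hθlow : (N : ℝ) / 2 ≤ d.totient * θ₁ := by linarith
  -- `θ₁ ≤ #{p ≤ N : p ≡ 1 (d)} · log N`
  have hset : ((Ioc 0 N).filter Nat.Prime).filter (fun p : ℕ => (p : ZMod d) = 1) =
      (Finset.Iic N).filter (fun p => p.Prime ∧ p ≡ 1 [MOD d]) := by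
    ext p
    simp only [Finset.mem_filter, Finset.mem_Ioc, Finset.mem_Iic]
    constructor
    · rintro ⟨⟨⟨-, hpN⟩, hpp⟩, hp1⟩
      refine ⟨hpN, hpp, ?_⟩
      have := (ZMod.natCast_eq_natCast_iff p 1 d).mp (by rw [hp1, Nat.cast_one])
      exact this
    · rintro ⟨hpN, hpp, hp1⟩
      refine ⟨⟨⟨hpp.pos, hpN⟩, hpp⟩, ?_⟩
      have := (ZMod.natCast_eq_natCast_iff p 1 d).mpr hp1
      rwa [Nat.cast_one] at this
  have hθup : θ₁ ≤ (((Finset.Iic N).filter (fun p => p.Prime ∧ p ≡ 1 [MOD d])).card : ℝ) *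
      Real.log N := by
    rw [hθ₁, hset]
    have := Finset.sum_le_card_nsmul ((Finset.Iic N).filter (fun p => p.Prime ∧ p ≡ 1 [MOD d]))
      (fun p => Real.log p) (Real.log N) (fun p hp => ?_)
    · rwa [nsmul_eq_mul] at this
    · obtain ⟨hpN, hpp, -⟩ := by simpa [Finset.mem_filter] using hp
      exact Real.log_le_log (by exact_mod_cast hpp.pos) (by exact_mod_cast hpN)
  -- conclude
  rw [div_le_iff₀ (by positivity)]
  have := mul_le_mul_of_nonneg_left hθup hφ0.le
  nlinarith

/-- **Primes `p ≡ 1 (mod d)` for all `d ≤ N^δ` off one exceptional modulus — UNCONDITIONAL**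
(Gallagher 1970, Theorem 7, consequence; hypothesis (H) of
`Literature/NumberTheory/Sieve/ShiftedPrimeDivisors.lean`): there are `c, δ > 0` (`c = 1/2`) and
`N₀` such that for every `N ≥ N₀` there is `b ≥ 2` with
`#{p ≤ N prime : p ≡ 1 (mod d)} ≥ c N/(φ(d) log N)` for all `1 ≤ d ≤ N^δ` with `b ∤ d`. From
`sum_norm_gallagherTerm_le_nonexceptional` (the DH-free Gallagher theorem of the tree, resting on the
explicit formulae and Bombieri's log-free zero-density theorem, all proved) by
`primesInAP_lowerBound_of_sumBound`. [cite: Gallagher1970, Theorem 7] -/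
theorem primesInAP_lowerBound :
    ∃ c : ℝ, 0 < c ∧ ∃ δ : ℝ, 0 < δ ∧ ∃ N₀ : ℕ, ∀ N : ℕ, N₀ ≤ N → ∃ b : ℕ, 2 ≤ b ∧
      ∀ d : ℕ, 1 ≤ d → (d : ℝ) ≤ (N : ℝ) ^ δ → ¬ b ∣ d →
        c * N / (Nat.totient d * Real.log N) ≤
          (((Finset.Iic N).filter (fun p => p.Prime ∧ p ≡ 1 [MOD d])).card : ℝ) :=
  primesInAP_lowerBound_of_sumBound sum_norm_gallagherTerm_le_nonexceptional

end PrimesInAPGallagher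

/-- **Adleman–Pomerance–Rumely 1983, Proposition 10 — UNCONDITIONAL.** There is an absolute
`C > 0` such that infinitely many `n` have at least `exp(C log n/log log n)` divisors `d` with
`d + 1` prime (the maximal order of the number `ω*(n)` of shifted-prime divisors up to the value of
`C`; "the lemma due to A. Odlyzko" of McCurley 1986, p. 926). The counting argument
`ShiftedPrimeDivisors.infinite_setOf_exp_le_card_shiftedPrimeDivisors` fed with the theorem
`PrimesInAPGallagher.primesInAP_lowerBound`. [cite: AdlemanPomeranceRumely1983, Proposition 10] -/
theorem AdlemanPomeranceRumely1983_prop10 :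
    ∃ C : ℝ, 0 < C ∧ {n : ℕ | Real.exp (C * Real.log n / Real.log (Real.log n)) ≤
      ((n.divisors.filter fun d => (d + 1).Prime).card : ℝ)}.Infinite :=
  ShiftedPrimeDivisors.infinite_setOf_exp_le_card_shiftedPrimeDivisors
    PrimesInAPGallagher.primesInAP_lowerBound

end Literature.NumberTheory.Sieve
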